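import Literature.Computability.FineGrained.BKGadgetClaim
import HarnessLib

/-!
# The Bringmann–Künnemann alignment gadget: the pieces of `x` facing the blocks `G(yⱼ)`

K. Bringmann, M. Künnemann, *Quadratic conditional lower bounds for string problems and dynamic
time warping*, FOCS 2015 (arXiv:1502.01063), §5.2, Claim 5.9 transported from the frame
`0^{γ₂} G(xᵢ) 0^{γ₂}` (`Params.claim59_frame`) to an arbitrary substring `x[a..b)` of
`x = G(x₁) 0^{γ₂} ⋯ G(x_n)` facing a block `G(yⱼ)` of `y` (`c_subst = 1`, `β = 4/5`, so
`β(γ₄ - |x[a..b)|)` becomes `4γ₄ - 4(b-a)` after multiplying by `5`):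

* `Params.piece_dichotomy`: either `5·editDist x[a..b) G(yⱼ) + 4(b-a) ≥ 4γ₄ + 5(ℓₓ+ℓ_y)` (the
  cases "`|x(G(yⱼ))| ≥ γ₂`" and `(*)` of the printed proof; `5(ℓₓ+ℓ_y) ≥ max_{i,j'} editDist xᵢ y_{j'}`),
  or `x[a..b)` contains exactly one `xᵢ` together with the symbol after it (the positions
  `[i(γ₄+γ₂)+4γ₁, i(γ₄+γ₂)+4γ₁+ℓₓ]`) and `5·editDist x[a..b) G(yⱼ) + 4(b-a) ≥ 4γ₄ + 5·editDist xᵢ yⱼ`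
  (the aligned case);
* `maxDist_le_add`: the punishment term is at most `ℓₓ + ℓ_y`;
* `Params.piece_bound`: the form consumed by the lower bound — with `j` aligned to the first `i`
  whose `xᵢ` (and the symbol after it) lies inside `x[a..b)` if there is one (`List.find?` over
  `Fin n`), and the punishment `maxᵢⱼ editDist xᵢ yⱼ` otherwise,
  `4γ₄ + 5·(editDist xᵢ yⱼ or max) ≤ 5·editDist x[a..b) G(yⱼ) + 4(b-a)` (print: Claim 5.9,
  `editDist(x(G(yⱼ)), G(yⱼ)) ≥ β(γ₄ - |x(G(yⱼ))|) + (editDist(xᵢ,yⱼ) if aligned, max otherwise)`).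

The frame of a short piece: if `b - a < γ₂` then, with `i = min ((a+γ₂)/(γ₄+γ₂)) (n-1)`, the piece
lies in `0^{γ₂} G(xᵢ) 0^{γ₂}`, which sits at offset `i(γ₄+γ₂)` in `0^{γ₂} x 0^{γ₂}`
(`Params.zeros_append_gadgetX_append_zeros`).
-/

namespace Literature.Computability.FineGrained

open Cryptography

namespace BKGadget

/-- The punishment term is at most `ℓₓ + ℓ_y`: `maxᵢⱼ editDist xᵢ yⱼ ≤ max(ℓₓ, ℓ_y) ≤ ℓₓ + ℓ_y`
(BK15, proof of Claim 5.9: "`ℓₓ + ℓ_y ≥ max_{i,j'} editDist(xᵢ, y_{j'})`"). [cite: BringmannKunnemannFOCS2015, Claim 5.9 (proof)] -/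
theorem maxDist_le_add {n m : ℕ} (P : Params) (x : Fin n → List Bool) (y : Fin m → List Bool)
    (hxlen : ∀ i, (x i).length = P.ℓx) (hylen : ∀ j, (y j).length = P.ℓy) :
    maxDist x y ≤ P.ℓx + P.ℓy := by
  refine Finset.sup_le fun p _ => (editDist_le_max_length _ _).trans ?_
  rw [hxlen, hylen]
  omega

/-- `[x₀, …, x_{n-1}] = [x₀,…,x_{i-1}] ++ [xᵢ] ++ [x_{i+1},…]`. [folklore] -/
theorem ofFn_eq_take_append_cons_drop {n : ℕ} (x : Fin n → List Bool) (i : Fin n) :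
    List.ofFn x = (List.ofFn x).take i ++ [x i] ++ (List.ofFn x).drop (i + 1) := by
  have hi : (i : ℕ) < (List.ofFn x).length := by simp
  conv_lhs => rw [← List.take_append_drop i (List.ofFn x), ← List.getElem_cons_drop hi]
  simp [List.getElem_ofFn]

namespace Params

variable (P : Params)

/-- **Claim 5.9 for a piece of `x`** (Bringmann–Künnemann, FOCS 2015, `c_subst = 1`): for a
substring `x[a..b)` of `x = G(x₁) 0^{γ₂} ⋯ G(x_n)` (inputs of type `(ℓₓ,sₓ)`, `ℓₓ ≤ ℓ_y = |yⱼ|`),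
either `4γ₄ + 5(ℓₓ+ℓ_y) ≤ 5·editDist x[a..b) G(yⱼ) + 4(b-a)` (cases `|x(G(yⱼ))| ≥ γ₂` and `(*)`),
or there is exactly one `i` with `[i(γ₄+γ₂)+4γ₁, i(γ₄+γ₂)+4γ₁+ℓₓ] ⊆ [a, b)` (the positions of `xᵢ`
and of the zero after it) and `4γ₄ + 5·editDist xᵢ yⱼ ≤ 5·editDist x[a..b) G(yⱼ) + 4(b-a)`.
[cite: BringmannKunnemannFOCS2015, Claim 5.9] -/
theorem piece_dichotomy {n m : ℕ} (x : Fin n → List Bool) (y : Fin m → List Bool) (hn : 1 ≤ n)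
    (hℓ : P.ℓx ≤ P.ℓy) (hxlen : ∀ i, (x i).length = P.ℓx) (hxcnt : ∀ i, (x i).count true = P.sx)
    (hylen : ∀ j, (y j).length = P.ℓy) {a b : ℕ} (hab : a ≤ b)
    (hb : b ≤ (P.gadgetX (List.ofFn x)).length) (j : Fin m) :
    4 * P.γ₄ + 5 * (P.ℓx + P.ℓy) ≤
        5 * editDist (((P.gadgetX (List.ofFn x)).take b).drop a) (P.guard (y j)) + 4 * (b - a) ∨
      ∃ i : Fin n, a ≤ (i : ℕ) * (P.γ₄ + P.γ₂) + 4 * P.γ₁ ∧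
        (i : ℕ) * (P.γ₄ + P.γ₂) + 4 * P.γ₁ + P.ℓx + 1 ≤ b ∧
        (∀ i' : Fin n, a ≤ (i' : ℕ) * (P.γ₄ + P.γ₂) + 4 * P.γ₁ →
          (i' : ℕ) * (P.γ₄ + P.γ₂) + 4 * P.γ₁ + P.ℓx + 1 ≤ b → i' = i) ∧
        4 * P.γ₄ + 5 * editDist (x i) (y j) ≤
          5 * editDist (((P.gadgetX (List.ofFn x)).take b).drop a) (P.guard (y j)) + 4 * (b - a) := by
  obtain ⟨X, hX⟩ : ∃ X, X = P.gadgetX (List.ofFn x) := ⟨_, rfl⟩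
  rw [← hX] at hb ⊢
  have hγ : P.γ₁ = 20 * (P.ℓx + P.ℓy) := rfl
  have hγ₂ : P.γ₂ = 239 * P.ℓx + 240 * P.ℓy + 5 * P.sx := rfl
  have hγ₄ : P.γ₄ = 8 * P.γ₁ + P.ℓx := rfl
  have hK : P.γ₄ + P.γ₂ = 5 * (4 * P.γ₁ + P.sx) := P.γ₄_add_γ₂
  have hsx : P.sx ≤ P.ℓx := by
    rw [← hxcnt ⟨0, hn⟩, ← hxlen ⟨0, hn⟩]; exact List.count_le_length
  have hXlen : X.length + P.γ₂ = n * (P.γ₄ + P.γ₂) := by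
    rw [hX, P.length_gadgetX (List.ofFn x) (List.forall_mem_ofFn_iff.2 hxlen), List.length_ofFn, hγ₄]
    obtain ⟨k, rfl⟩ : ∃ k, n = k + 1 := ⟨n - 1, by omega⟩
    simp only [Nat.add_sub_cancel]
    ring
  -- the piece and `G(yⱼ)`: lengths
  have hplen : ((X.take b).drop a).length = b - a := by rw [length_drop_take', min_eq_left hb]
  have hElen : (P.guard (y j)).length ≤
      editDist ((X.take b).drop a) (P.guard (y j)) + ((X.take b).drop a).length :=
    length_le_editDist_add_length_left _ _
  rw [length_guard, hylen, hplen] at hElen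
  by_cases hlong : P.γ₂ ≤ b - a
  · -- a piece of length `≥ γ₂` is too long
    left; omega
  · push Not at hlong
    -- the block `i₀` in whose frame the piece lies
    have hKpos : 0 < P.γ₄ + P.γ₂ := by omega
    obtain ⟨i₀, hi₀⟩ : ∃ i₀, i₀ = min ((a + P.γ₂) / (P.γ₄ + P.γ₂)) (n - 1) := ⟨_, rfl⟩
    have hi₀n : i₀ < n := by rw [hi₀]; omega
    have hc₀a : i₀ * (P.γ₄ + P.γ₂) ≤ a + P.γ₂ :=
      (Nat.mul_le_mul_right _ (hi₀ ▸ min_le_left _ _)).trans (Nat.div_mul_le_self _ _)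
    have hc₀b : b + P.γ₂ ≤ i₀ * (P.γ₄ + P.γ₂) + P.γ₄ + 2 * P.γ₂ := by
      rcases lt_or_ge ((a + P.γ₂) / (P.γ₄ + P.γ₂)) (n - 1) with h | h
      · have h1 : i₀ = (a + P.γ₂) / (P.γ₄ + P.γ₂) := by rw [hi₀, min_eq_left h.le]
        have h2 := Nat.lt_div_mul_add (a := a + P.γ₂) hKpos
        rw [← h1] at h2
        omega
      · have h1 : i₀ = n - 1 := by rw [hi₀, min_eq_right h]
        have h2 : (i₀ + 1) * (P.γ₄ + P.γ₂) = n * (P.γ₄ + P.γ₂) := by rw [h1, Nat.sub_add_cancel hn]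
        rw [Nat.succ_mul] at h2
        omega
    -- the frame `S = 0^{γ₂} G(x_{i₀}) 0^{γ₂}` sits at offset `i₀ (γ₄+γ₂)` in `0^{γ₂} x 0^{γ₂}`
    have hsplit := ofFn_eq_take_append_cons_drop x ⟨i₀, hi₀n⟩
    have hpre_len : (((List.ofFn x).take i₀).map fun z => zeros P.γ₂ ++ P.guard z).flatten.length =
        i₀ * (P.γ₄ + P.γ₂) := by
      rw [P.length_flatten_map_zeros_append_guard _ fun z hz => ?_, hK, List.length_take,
        List.length_ofFn, min_eq_left hi₀n.le]
      obtain ⟨i, rfl⟩ := (List.mem_ofFn' _ _).1 (List.mem_of_mem_take hz)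
      exact hxlen i
    have hT := P.zeros_append_gadgetX_append_zeros ((List.ofFn x).take i₀) (x ⟨i₀, hi₀n⟩)
      ((List.ofFn x).drop (i₀ + 1))
    rw [← hsplit, ← hX] at hT
    -- the piece in the coordinates of `0^{γ₂} x 0^{γ₂}` …
    have h1 := drop_take_append_middle (zeros P.γ₂) X (zeros P.γ₂) (u := a) hb
    rw [length_zeros, hT] at h1
    -- … and in the coordinates of the frame
    have h2 := drop_take_append_middle
      (((List.ofFn x).take i₀).map fun z => zeros P.γ₂ ++ P.guard z).flatten
      (zeros P.γ₂ ++ P.guard (x ⟨i₀, hi₀n⟩) ++ zeros P.γ₂)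
      (((List.ofFn x).drop (i₀ + 1)).map fun z => P.guard z ++ zeros P.γ₂).flatten
      (u := a + P.γ₂ - i₀ * (P.γ₄ + P.γ₂)) (v := b + P.γ₂ - i₀ * (P.γ₄ + P.γ₂))
      (by simp only [List.length_append, length_zeros, length_guard, hxlen]; omega)
    rw [hpre_len, show i₀ * (P.γ₄ + P.γ₂) + (b + P.γ₂ - i₀ * (P.γ₄ + P.γ₂)) = P.γ₂ + b by omega,
      show i₀ * (P.γ₄ + P.γ₂) + (a + P.γ₂ - i₀ * (P.γ₄ + P.γ₂)) = P.γ₂ + a by omega, h1] at h2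
    -- `h2 : x[a..b) = S[a+γ₂-c₀ .. b+γ₂-c₀)`; apply Claim 5.9 in the frame
    rw [h2]
    rcases P.claim59_frame (x ⟨i₀, hi₀n⟩) (y j) (hxlen _) (s := a + P.γ₂ - i₀ * (P.γ₄ + P.γ₂))
        (e := b + P.γ₂ - i₀ * (P.γ₄ + P.γ₂)) (by omega) (by omega) with hA | ⟨hds, hde, hmain⟩
    · -- case `(*)`
      left
      rw [← h2] at hA ⊢
      omega
    · -- the aligned case: `i₀` is the unique input block inside the piece
      right
      refine ⟨⟨i₀, hi₀n⟩, ?_, ?_, ?_, ?_⟩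
      · show a ≤ i₀ * (P.γ₄ + P.γ₂) + 4 * P.γ₁
        omega
      · show i₀ * (P.γ₄ + P.γ₂) + 4 * P.γ₁ + P.ℓx + 1 ≤ b
        omega
      · intro i' h1' h2'
        apply Fin.ext
        show (i' : ℕ) = i₀
        rcases lt_trichotomy (i' : ℕ) i₀ with hlt | heq | hgt
        · exfalso
          have h3 := Nat.mul_le_mul_right (P.γ₄ + P.γ₂) (Nat.succ_le_of_lt hlt)
          rw [Nat.succ_mul] at h3
          omega
        · exact heq
        · exfalso
          have h3 := Nat.mul_le_mul_right (P.γ₄ + P.γ₂) (Nat.succ_le_of_lt hgt)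
          rw [Nat.succ_mul] at h3
          omega
      · rw [← h2] at hmain ⊢
        omega

/-- **The bound for a piece facing `G(yⱼ)`, as consumed by the lower bound** (BK15, Claim 5.9
with the alignment rule of the proof of Lemma 5.4): align `j` with the first `i` such that `xᵢ`
and the zero after it lie inside the piece `x[a..b)`, if any; then
`4γ₄ + 5·(editDist xᵢ yⱼ if aligned, maxᵢⱼ editDist xᵢ yⱼ otherwise) ≤ 5·editDist x[a..b) G(yⱼ) + 4(b-a)`.
[cite: BringmannKunnemannFOCS2015, Claim 5.9] -/
theorem piece_bound {n m : ℕ} (x : Fin n → List Bool) (y : Fin m → List Bool) (hn : 1 ≤ n)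
    (hℓ : P.ℓx ≤ P.ℓy) (hxlen : ∀ i, (x i).length = P.ℓx) (hxcnt : ∀ i, (x i).count true = P.sx)
    (hylen : ∀ j, (y j).length = P.ℓy) {a b : ℕ} (hab : a ≤ b)
    (hb : b ≤ (P.gadgetX (List.ofFn x)).length) (j : Fin m) :
    4 * P.γ₄ + 5 * ((List.finRange n).find? (fun i : Fin n =>
        decide (a ≤ (i : ℕ) * (P.γ₄ + P.γ₂) + 4 * P.γ₁ ∧
          (i : ℕ) * (P.γ₄ + P.γ₂) + 4 * P.γ₁ + P.ℓx + 1 ≤ b))).elim (maxDist x y)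
        (fun i => editDist (x i) (y j)) ≤
      5 * editDist (((P.gadgetX (List.ofFn x)).take b).drop a) (P.guard (y j)) + 4 * (b - a) := by
  have hmax := maxDist_le_add P x y hxlen hylen
  rcases P.piece_dichotomy x y hn hℓ hxlen hxcnt hylen hab hb j with h | ⟨i, hi1, hi2, huniq, h⟩
  · refine le_trans ?_ h
    cases hf : (List.finRange n).find? (fun i : Fin n =>
        decide (a ≤ (i : ℕ) * (P.γ₄ + P.γ₂) + 4 * P.γ₁ ∧
          (i : ℕ) * (P.γ₄ + P.γ₂) + 4 * P.γ₁ + P.ℓx + 1 ≤ b)) with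
    | none => simpa using hmax
    | some i =>
        have := editDist_le_maxDist x y i j
        simp only [Option.elim_some]
        omega
  · cases hf : (List.finRange n).find? (fun i : Fin n =>
        decide (a ≤ (i : ℕ) * (P.γ₄ + P.γ₂) + 4 * P.γ₁ ∧
          (i : ℕ) * (P.γ₄ + P.γ₂) + 4 * P.γ₁ + P.ℓx + 1 ≤ b)) with
    | none =>
        exfalso
        have := (List.find?_eq_none.1 hf) i (List.mem_finRange i)
        simp [hi1, hi2] at this
    | some i' =>
        have hp := List.find?_some hf
        simp only [decide_eq_true_eq] at hp
        rw [huniq i' hp.1 hp.2]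
        simpa using h

end Params

end BKGadget

end Literature.Computability.FineGrained
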